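import Literature.AlgebraicGeometry.Smoothening.DefectZeroSmooth
import HarnessLib

/-!
# Free pull-back of the differentials implies smoothness at the closed point
# (BLR Lemma 3.3/1 ⟹, for points with values in a local domain)

Topic: `Literature/AlgebraicGeometry/Smoothening`. Bosch–Lütkebohmert–Raynaud, *Néron Models*,
Lemma 3.3/1 ⟹ (M. Artin, *Néron Models*, (3.8): "`l(x') = 0` if and only if `V` is smooth at
`x'`") is proved in `DefectZeroSmooth.lean` (`isSmoothAt_of_neronDefect_eq_zero`) for points
`a : A = R[T₁, …, Tₙ]/I → R'` with values in a DISCRETE VALUATION RING `R'`, where the hypothesis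
`δ(a) = 0` is used exactly once: it makes the pull-back `a*Ω¹_{X/R} = R' ⊗_A Ω[A⁄R]` a free
`R'`-module (`neronDefect_eq_zero_iff_free`). The rest of the printed argument only uses that
`R'` is a local domain (its residue field `k'` and fraction field `K'`, and that an element of
`R'` non-zero in `k'` is a unit). This file records the resulting form of the lemma for points
with values in an arbitrary LOCAL DOMAIN `R'` — the form needed for sections with values in a
general valuation ring (the valuative Jacobian criterion; over a valuation ring "free" is the
same as "flat", finitely generated flat modules over local rings being free):

* `isSmoothAt_of_free_baseChange_kaehler` — `R` Noetherian regular, `A = R[T₁, …, Tₙ]/I`,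
  `a : A → R'` with `R'` a local domain; if `A` is smooth over `R` at the generic point
  `a⁻¹(0)` of the section and `R' ⊗_A Ω[A⁄R]` is free over `R'`, then `A` is smooth over `R` at
  the closed point `a⁻¹(𝔪')`;
* `isSmoothAt_of_flat_baseChange_kaehler` — the same with "flat" in place of "free".

Proof: verbatim Steps 2–8 of `isSmoothAt_of_neronDefect_eq_zero` (fibre dimension `r` at `k'`;
relations `f₁, …, f_{n-r} ∈ I` with a Jacobian minor `Δ` invertible at the closed point,
`JacobianLift`; the smooth chart `C = (R[T]/(f))[1/Δ] ↠ A[1/Δ]` with kernel `J`,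
`JacobianChart`; at the generic point of the section the fibre map of the differentials is a
surjection of `K'`-spaces of equal dimension `r`, hence injective, so `J C_{𝔮₀} = 0` by the
conormal criterion `ConormalLocalization`; `C_𝔮` is regular (EGA IV 17.5.8 (iii)) hence a
domain, so `J C_𝔮 = 0` and `A_𝔭 ≅ C_𝔮` is formally smooth).

No named facts are introduced (D-0026).

## References

* S. Bosch, W. Lütkebohmert, M. Raynaud, *Néron Models*, Springer 1990, Lemma 3.3/1.
  [BLRNeronModels1990] (Not held; number only.)
* M. Artin, *Néron Models*, in Cornell–Silverman (eds.), *Arithmetic Geometry*, Springer 1986,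
  (3.8) (p. 226). [Artin1986NeronModels]
* U. Görtz, T. Wedhorn, *Algebraic Geometry II*, 2023, Thm. 18.74, Prop. 18.76.
  [GortzWedhorn2023]
* A. Grothendieck, EGA IV₄, Prop. 17.5.8 (iii). [Grothendieck1967]
-/

noncomputable section

open scoped TensorProduct
open MvPolynomial IsLocalRing Literature.AlgebraicGeometry.Resolution

namespace Literature.AlgebraicGeometry.Smoothening

universe u

section Main

variable {R : Type u} [CommRing R] [IsRegularRing R] {n : ℕ}
  (I : Ideal (MvPolynomial (Fin n) R))
  (R' : Type u) [CommRing R'] [IsDomain R'] [IsLocalRing R']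
  [Algebra (MvPolynomial (Fin n) R ⧸ I) R']

set_option maxHeartbeats 800000 in
/-- **BLR Lemma 3.3/1 ⟹ for points with values in a local domain**: `R` a Noetherian regular
ring, `A = R[T₁, …, Tₙ]/I`, `a : A → R'` a point with values in a local domain `R'`; if `A` is
smooth over `R` at the generic point `a⁻¹(0)` of the section and the pull-back
`a*Ω¹ = R' ⊗_A Ω[A⁄R]` of the differentials is a free `R'`-module, then `A` is smooth over `R`
at the closed point `a⁻¹(𝔪')` of the section (Artin (3.8): "`l(x') = 0` if and only if `V` is
smooth at `x'`"; for a discrete valuation ring `R'`, `l = δ(a) = 0` iff `a*Ω¹` is free). See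
the module docstring for the proof. [cite: Artin1986NeronModels, (3.8) (p. 226)] -/
theorem isSmoothAt_of_free_baseChange_kaehler
    (hQ : Algebra.IsSmoothAt R
      ((⊥ : Ideal R').comap (algebraMap (MvPolynomial (Fin n) R ⧸ I) R')))
    (hfree : Module.Free R'
      (R' ⊗[MvPolynomial (Fin n) R ⧸ I] Ω[(MvPolynomial (Fin n) R ⧸ I)⁄R])) :
    Algebra.IsSmoothAt R
      ((maximalIdeal R').comap (algebraMap (MvPolynomial (Fin n) R ⧸ I) R')) := by
  classical
  -- Step 1: `a*Ω` is finite free, of rank `r`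
  haveI : Algebra.FiniteType R (MvPolynomial (Fin n) R ⧸ I) := inferInstance
  haveI : Module.Finite (MvPolynomial (Fin n) R ⧸ I) Ω[(MvPolynomial (Fin n) R ⧸ I)⁄R] :=
    inferInstance
  haveI := hfree
  set r := Module.finrank R' (R' ⊗[MvPolynomial (Fin n) R ⧸ I] Ω[(MvPolynomial (Fin n) R ⧸ I)⁄R])
    with hr
  -- Step 2: the closed point `A → R' → k` (and `B → A → R'`), fibre dimension at `k`
  letI algBR' : Algebra (MvPolynomial (Fin n) R) R' :=
    ((algebraMap (MvPolynomial (Fin n) R ⧸ I) R').comp (Ideal.Quotient.mk I)).toAlgebra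
  haveI : IsScalarTower (MvPolynomial (Fin n) R) (MvPolynomial (Fin n) R ⧸ I) R' :=
    IsScalarTower.of_algebraMap_eq (R := MvPolynomial (Fin n) R) (S := MvPolynomial (Fin n) R ⧸ I)
      (A := R') fun x => rfl
  haveI : IsScalarTower (MvPolynomial (Fin n) R) (MvPolynomial (Fin n) R ⧸ I) (ResidueField R') :=
    IsScalarTower.of_algebraMap_eq (R := MvPolynomial (Fin n) R) (S := MvPolynomial (Fin n) R ⧸ I)
      (A := ResidueField R') fun x => rfl
  have hdk : Module.finrank (ResidueField R')
      (ResidueField R' ⊗[MvPolynomial (Fin n) R ⧸ I] Ω[(MvPolynomial (Fin n) R ⧸ I)⁄R]) = r := by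
    rw [← (TensorProduct.AlgebraTensorModule.cancelBaseChange (MvPolynomial (Fin n) R ⧸ I) R'
      (ResidueField R') (ResidueField R') Ω[(MvPolynomial (Fin n) R ⧸ I)⁄R]).finrank_eq,
      Module.finrank_baseChange]
  have hdn : r ≤ n := by
    -- `k ⊗_B Ω_B ≅ kⁿ` surjects onto `k ⊗_A Ω_A`
    have hsurj := fibreMap_surjective_of_surjective R (MvPolynomial (Fin n) R)
      (MvPolynomial (Fin n) R ⧸ I) (ResidueField R') Ideal.Quotient.mk_surjective
    haveI : FiniteDimensional (ResidueField R')
        (ResidueField R' ⊗[MvPolynomial (Fin n) R] Ω[MvPolynomial (Fin n) R⁄R]) :=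
      Module.Finite.of_basis (tensorKaehlerBasis (ResidueField R'))
    have h1 := LinearMap.finrank_range_le (fibreMap R (MvPolynomial (Fin n) R)
      (MvPolynomial (Fin n) R ⧸ I) (ResidueField R'))
    rw [LinearMap.range_eq_top.mpr hsurj, finrank_top, hdk,
      Module.finrank_eq_card_basis (tensorKaehlerBasis (ResidueField R')), Fintype.card_fin] at h1
    exact h1
  -- Step 3: relations with an invertible minor at the closed point
  obtain ⟨f, hf, a, ha, hΔ⟩ := exists_jacobianMinor_ne_zero I (ResidueField R') hdk hdn
  -- Step 4: the chart `C = (B/(f))[1/Δ]`, `AL = A[1/Δ_A]`, `T = C/J ≅ AL`, and the points on them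
  have hΔA : IsUnit (algebraMap (MvPolynomial (Fin n) R ⧸ I) R' (minorImage I f hf a ha)) := by
    rw [← residue_ne_zero_iff_isUnit, minorImage_eq_mk]
    exact hΔ
  letI algALR' : Algebra (ALoc I f hf a ha) R' :=
    (IsLocalization.Away.lift (minorImage I f hf a ha) hΔA).toAlgebra
  have hALR' : ∀ x : MvPolynomial (Fin n) R ⧸ I,
      algebraMap (ALoc I f hf a ha) R' (algebraMap _ (ALoc I f hf a ha) x) = algebraMap _ R' x :=
    fun x => IsLocalization.Away.lift_eq (minorImage I f hf a ha) hΔA x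
  haveI : IsScalarTower (MvPolynomial (Fin n) R ⧸ I) (ALoc I f hf a ha) R' :=
    IsScalarTower.of_algebraMap_eq (R := MvPolynomial (Fin n) R ⧸ I) (S := ALoc I f hf a ha)
      (A := R') fun x => (hALR' x).symm
  letI algCAL : Algebra (Chart f a ha) (ALoc I f hf a ha) :=
    (chartToALoc I f hf a ha).toRingHom.toAlgebra
  have hCAL : ∀ c, algebraMap (Chart f a ha) (ALoc I f hf a ha) c = chartToALoc I f hf a ha c :=
    fun c => rfl
  haveI : IsScalarTower R (Chart f a ha) (ALoc I f hf a ha) :=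
    IsScalarTower.of_algebraMap_eq (R := R) (S := Chart f a ha) (A := ALoc I f hf a ha)
      fun x => ((chartToALoc I f hf a ha).commutes x).symm
  letI algCR' : Algebra (Chart f a ha) R' :=
    ((algebraMap (ALoc I f hf a ha) R').comp (algebraMap (Chart f a ha) (ALoc I f hf a ha))).toAlgebra
  haveI : IsScalarTower (Chart f a ha) (ALoc I f hf a ha) R' :=
    IsScalarTower.of_algebraMap_eq (R := Chart f a ha) (S := ALoc I f hf a ha) (A := R') fun x => rfl
  -- `T = C/J`
  letI algTAL : Algebra (Chart f a ha ⧸ chartKer I f hf a ha) (ALoc I f hf a ha) :=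
    (chartQuotEquiv I f hf a ha).toAlgHom.toRingHom.toAlgebra
  have hTAL : ∀ c : Chart f a ha, algebraMap (Chart f a ha ⧸ chartKer I f hf a ha) (ALoc I f hf a ha)
      (Ideal.Quotient.mk _ c) = chartToALoc I f hf a ha c :=
    fun c => Ideal.quotientKerAlgEquivOfSurjective_mk _ c
  haveI : IsScalarTower (Chart f a ha) (Chart f a ha ⧸ chartKer I f hf a ha) (ALoc I f hf a ha) :=
    IsScalarTower.of_algebraMap_eq (R := Chart f a ha) (S := Chart f a ha ⧸ chartKer I f hf a ha)
      (A := ALoc I f hf a ha) fun c => (hTAL c).symm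
  haveI : IsScalarTower R (Chart f a ha ⧸ chartKer I f hf a ha) (ALoc I f hf a ha) :=
    IsScalarTower.of_algebraMap_eq (R := R) (S := Chart f a ha ⧸ chartKer I f hf a ha)
      (A := ALoc I f hf a ha) fun x => ((chartQuotEquiv I f hf a ha).commutes x).symm
  letI algTR' : Algebra (Chart f a ha ⧸ chartKer I f hf a ha) R' :=
    ((algebraMap (ALoc I f hf a ha) R').comp
      (algebraMap (Chart f a ha ⧸ chartKer I f hf a ha) (ALoc I f hf a ha))).toAlgebra
  haveI : IsScalarTower (Chart f a ha ⧸ chartKer I f hf a ha) (ALoc I f hf a ha) R' :=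
    IsScalarTower.of_algebraMap_eq (R := Chart f a ha ⧸ chartKer I f hf a ha)
      (S := ALoc I f hf a ha) (A := R') fun x => rfl
  haveI : IsScalarTower (Chart f a ha) (Chart f a ha ⧸ chartKer I f hf a ha) R' :=
    IsScalarTower.of_algebraMap_eq (R := Chart f a ha) (S := Chart f a ha ⧸ chartKer I f hf a ha)
      (A := R') fun c => by
        change algebraMap (ALoc I f hf a ha) R' (algebraMap (Chart f a ha) (ALoc I f hf a ha) c) =
          algebraMap (ALoc I f hf a ha) R' (algebraMap _ (ALoc I f hf a ha) (Ideal.Quotient.mk _ c))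
        rw [hTAL, hCAL]
  -- towers into `K = FractionRing R'` (all through `R'`)
  haveI towCTK : IsScalarTower (Chart f a ha) (Chart f a ha ⧸ chartKer I f hf a ha) (FractionRing R') :=
    IsScalarTower.of_algebraMap_eq (R := Chart f a ha) (S := Chart f a ha ⧸ chartKer I f hf a ha)
      (A := FractionRing R') fun c => by
        rw [IsScalarTower.algebraMap_apply (Chart f a ha) R' (FractionRing R'),
          IsScalarTower.algebraMap_apply (Chart f a ha ⧸ chartKer I f hf a ha) R' (FractionRing R'),
          ← IsScalarTower.algebraMap_apply (Chart f a ha) (Chart f a ha ⧸ chartKer I f hf a ha) R']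
  haveI towCALK : IsScalarTower (Chart f a ha) (ALoc I f hf a ha) (FractionRing R') :=
    IsScalarTower.of_algebraMap_eq (R := Chart f a ha) (S := ALoc I f hf a ha)
      (A := FractionRing R') fun c => by
        rw [IsScalarTower.algebraMap_apply (Chart f a ha) R' (FractionRing R'),
          IsScalarTower.algebraMap_apply (ALoc I f hf a ha) R' (FractionRing R'),
          ← IsScalarTower.algebraMap_apply (Chart f a ha) (ALoc I f hf a ha) R']
  haveI towTALK : IsScalarTower (Chart f a ha ⧸ chartKer I f hf a ha) (ALoc I f hf a ha)
      (FractionRing R') :=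
    IsScalarTower.of_algebraMap_eq (R := Chart f a ha ⧸ chartKer I f hf a ha) (S := ALoc I f hf a ha)
      (A := FractionRing R') fun c => by
        rw [IsScalarTower.algebraMap_apply (Chart f a ha ⧸ chartKer I f hf a ha) R' (FractionRing R'),
          IsScalarTower.algebraMap_apply (ALoc I f hf a ha) R' (FractionRing R'),
          ← IsScalarTower.algebraMap_apply (Chart f a ha ⧸ chartKer I f hf a ha) (ALoc I f hf a ha) R']
  haveI towAALK : IsScalarTower (MvPolynomial (Fin n) R ⧸ I) (ALoc I f hf a ha) (FractionRing R') :=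
    IsScalarTower.of_algebraMap_eq (R := MvPolynomial (Fin n) R ⧸ I) (S := ALoc I f hf a ha)
      (A := FractionRing R') fun x => by
        rw [IsScalarTower.algebraMap_apply (MvPolynomial (Fin n) R ⧸ I) R' (FractionRing R'),
          IsScalarTower.algebraMap_apply (ALoc I f hf a ha) R' (FractionRing R'), hALR']
  -- Step 5: the fibre map at the generic point `K` is injective
  have hsurjCAL : Function.Surjective (algebraMap (Chart f a ha) (ALoc I f hf a ha)) :=
    chartToALoc_surjective I f hf a ha
  have hfs : Function.Surjective (fibreMap R (Chart f a ha) (ALoc I f hf a ha) (FractionRing R')) :=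
    fibreMap_surjective_of_surjective R _ _ _ hsurjCAL
  haveI : Nontrivial (Chart f a ha) := (algebraMap (Chart f a ha) R').domain_nontrivial
  haveI hss : Algebra.IsStandardSmoothOfRelativeDimension (n - (n - r)) R (Chart f a ha) :=
    isStandardSmoothOfRelativeDimension_away f a ha (Chart f a ha)
  haveI : Algebra.IsStandardSmooth R (Chart f a ha) := hss.isStandardSmooth
  have hrankC : Module.finrank (Chart f a ha) Ω[Chart f a ha⁄R] = r := by
    have h := Algebra.IsStandardSmoothOfRelativeDimension.rank_kaehlerDifferential
      (R := R) (S := Chart f a ha) (n - (n - r))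
    have h' : Module.finrank (Chart f a ha) Ω[Chart f a ha⁄R] = n - (n - r) :=
      Module.finrank_eq_of_rank_eq h
    rw [h']
    omega
  have hdimsrc : Module.finrank (FractionRing R')
      (FractionRing R' ⊗[Chart f a ha] Ω[Chart f a ha⁄R]) = r := by
    rw [Module.finrank_baseChange, hrankC]
  have hbij := fibreMap_bijective_of_isLocalization R (MvPolynomial (Fin n) R ⧸ I)
    (ALoc I f hf a ha) (FractionRing R') (Submonoid.powers (minorImage I f hf a ha))
  have hdimtgt : Module.finrank (FractionRing R')
      (FractionRing R' ⊗[ALoc I f hf a ha] Ω[ALoc I f hf a ha⁄R]) = r := by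
    rw [← (LinearEquiv.ofBijective _ hbij).finrank_eq,
      ← (TensorProduct.AlgebraTensorModule.cancelBaseChange (MvPolynomial (Fin n) R ⧸ I) R'
        (FractionRing R') (FractionRing R') Ω[(MvPolynomial (Fin n) R ⧸ I)⁄R]).finrank_eq,
      Module.finrank_baseChange]
  haveI : FiniteDimensional (FractionRing R')
      (FractionRing R' ⊗[ALoc I f hf a ha] Ω[ALoc I f hf a ha⁄R]) :=
    Module.Finite.of_surjective _ hfs
  have hinjCAL : Function.Injective (fibreMap R (Chart f a ha) (ALoc I f hf a ha) (FractionRing R')) :=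
    (LinearMap.injective_iff_surjective_of_finrank_eq_finrank (hdimsrc.trans hdimtgt.symm)).mpr hfs
  have hinjCT : Function.Injective
      (fibreMap R (Chart f a ha) (Chart f a ha ⧸ chartKer I f hf a ha) (FractionRing R')) := by
    have hc := fibreMap_comp R (Chart f a ha) (Chart f a ha ⧸ chartKer I f hf a ha)
      (FractionRing R') (ALoc I f hf a ha)
    have hc' : ⇑(fibreMap R (Chart f a ha ⧸ chartKer I f hf a ha) (ALoc I f hf a ha)
        (FractionRing R')) ∘
        ⇑(fibreMap R (Chart f a ha) (Chart f a ha ⧸ chartKer I f hf a ha) (FractionRing R')) =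
        ⇑(fibreMap R (Chart f a ha) (ALoc I f hf a ha) (FractionRing R')) := by
      rw [← LinearMap.coe_comp, hc]
    exact Function.Injective.of_comp (by rw [hc']; exact hinjCAL)
  -- Step 6: the conormal criterion at the generic prime `𝔮₀ = ker (C → R')`
  set 𝔮₀ : Ideal (Chart f a ha) := (⊥ : Ideal R').comap (algebraMap (Chart f a ha) R') with h𝔮₀
  haveI : Algebra.FormallySmooth R (Chart f a ha) := formallySmooth_chart f a ha
  have hJfg : (chartKer I f hf a ha).FG := IsNoetherian.noetherian _
  have hJle : chartKer I f hf a ha ≤ 𝔮₀ := fun c hc => by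
    change algebraMap (Chart f a ha) R' c ∈ (⊥ : Ideal R')
    rw [Ideal.mem_bot]
    change algebraMap (ALoc I f hf a ha) R' (chartToALoc I f hf a ha c) = 0
    rw [show chartToALoc I f hf a ha c = 0 from hc, map_zero]
  haveI := isPrime_map_mk (chartKer I f hf a ha) 𝔮₀ hJle
  -- the ideals `ker (T → R')`, `ker (A → R')` in their various guises
  have hkerT : 𝔮₀.map (Ideal.Quotient.mk (chartKer I f hf a ha)) =
      (⊥ : Ideal R').comap (algebraMap (Chart f a ha ⧸ chartKer I f hf a ha) R') := by
    rw [h𝔮₀, IsScalarTower.algebraMap_eq (Chart f a ha) (Chart f a ha ⧸ chartKer I f hf a ha) R',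
      ← Ideal.comap_comap, Ideal.Quotient.algebraMap_eq,
      Ideal.map_comap_of_surjective _ Ideal.Quotient.mk_surjective]
  have hkerT' : ((⊥ : Ideal R').comap (algebraMap (ALoc I f hf a ha) R')).comap
        (chartQuotEquiv I f hf a ha).toRingEquiv.toRingHom =
      (⊥ : Ideal R').comap (algebraMap (Chart f a ha ⧸ chartKer I f hf a ha) R') := by
    rw [Ideal.comap_comap]
    rfl
  have hkerA : ((⊥ : Ideal R').comap (algebraMap (ALoc I f hf a ha) R')).comap
        (algebraMap (MvPolynomial (Fin n) R ⧸ I) (ALoc I f hf a ha)) =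
      (⊥ : Ideal R').comap (algebraMap (MvPolynomial (Fin n) R ⧸ I) R') := by
    rw [Ideal.comap_comap, ← IsScalarTower.algebraMap_eq]
  have hT : Algebra.IsSmoothAt R (𝔮₀.map (Ideal.Quotient.mk (chartKer I f hf a ha))) := by
    have key : Algebra.IsSmoothAt R (((⊥ : Ideal R').comap (algebraMap (ALoc I f hf a ha) R')).comap
        (chartQuotEquiv I f hf a ha).toRingEquiv.toRingHom) := by
      refine (isSmoothAt_chartQuot_iff I f hf a ha
        ((⊥ : Ideal R').comap (algebraMap (ALoc I f hf a ha) R'))).mpr ?_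
      convert hQ using 2
    convert key using 2
    exact hkerT.trans hkerT'.symm
  have hkerK : RingHom.ker (algebraMap (Chart f a ha) (FractionRing R')) = 𝔮₀ := by
    rw [h𝔮₀, IsScalarTower.algebraMap_eq (Chart f a ha) R' (FractionRing R'), ← RingHom.comap_ker,
      (RingHom.injective_iff_ker_eq_bot _).mp (IsFractionRing.injective R' (FractionRing R'))]
  have hJ0 := map_eq_bot_of_isSmoothAt_of_injective R (Chart f a ha) (chartKer I f hf a ha) 𝔮₀
    (FractionRing R') hJfg hJle hT hkerK hinjCT
  -- Step 7: the closed prime `𝔮`; `C_𝔮` is a domain, so `J C_𝔮 = 0` as well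
  set 𝔮 : Ideal (Chart f a ha) := (maximalIdeal R').comap (algebraMap (Chart f a ha) R') with h𝔮
  have h𝔮₀𝔮 : 𝔮₀ ≤ 𝔮 := Ideal.comap_mono bot_le
  haveI : Algebra.Smooth R (Chart f a ha) := smooth_away f a ha (Chart f a ha)
  haveI : IsDomain (Localization.AtPrime 𝔮) := isDomain_localization_of_smooth R (Chart f a ha) 𝔮
  have hJ𝔮 : (chartKer I f hf a ha).map (algebraMap (Chart f a ha) (Localization.AtPrime 𝔮)) = ⊥ := by
    rw [Ideal.map_eq_bot_iff_le_ker]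
    intro j hj
    rw [RingHom.mem_ker]
    have hj0 : algebraMap (Chart f a ha) (Localization.AtPrime 𝔮₀) j = 0 := by
      have := Ideal.mem_map_of_mem (algebraMap (Chart f a ha) (Localization.AtPrime 𝔮₀)) hj
      rwa [hJ0, Ideal.mem_bot] at this
    obtain ⟨⟨t, ht⟩, htj⟩ :=
      (IsLocalization.map_eq_zero_iff 𝔮₀.primeCompl (Localization.AtPrime 𝔮₀) j).mp hj0
    have ht0 : algebraMap (Chart f a ha) (Localization.AtPrime 𝔮) t ≠ 0 := by
      intro h0
      obtain ⟨⟨s, hs⟩, hst⟩ :=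
        (IsLocalization.map_eq_zero_iff 𝔮.primeCompl (Localization.AtPrime 𝔮) t).mp h0
      have e := congrArg (algebraMap (Chart f a ha) R') hst
      simp only [map_mul, map_zero] at e
      rcases mul_eq_zero.mp e with h | h
      · exact hs (show algebraMap (Chart f a ha) R' s ∈ maximalIdeal R' by rw [h]; exact zero_mem _)
      · exact ht (show algebraMap (Chart f a ha) R' t ∈ (⊥ : Ideal R') by rw [h]; exact zero_mem _)
    have e := congrArg (algebraMap (Chart f a ha) (Localization.AtPrime 𝔮)) htj
    simp only [map_mul, map_zero] at e
    exact (mul_eq_zero.mp e).resolve_left ht0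
  -- Step 8: `C_𝔮/JC_𝔮 = C_𝔮` is formally smooth, i.e. `T` is smooth at `𝔮/J`, i.e. `A` at `𝔭`
  have hfsq : Algebra.FormallySmooth R (Localization.AtPrime 𝔮 ⧸
      (chartKer I f hf a ha).map (algebraMap (Chart f a ha) (Localization.AtPrime 𝔮))) := by
    rw [hJ𝔮]
    have hk : RingHom.ker (AlgHom.id R (Localization.AtPrime 𝔮)) = (⊥ : Ideal _) :=
      (RingHom.injective_iff_ker_eq_bot _).mp fun _ _ h => h
    exact Algebra.FormallySmooth.of_equiv
      ((Ideal.quotientKerAlgEquivOfSurjective (f := AlgHom.id R (Localization.AtPrime 𝔮))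
        Function.surjective_id).symm.trans (Ideal.quotientEquivAlgOfEq R hk))
  haveI := isPrime_map_mk (chartKer I f hf a ha) 𝔮 (hJle.trans h𝔮₀𝔮)
  have hT𝔮 : Algebra.IsSmoothAt R (𝔮.map (Ideal.Quotient.mk (chartKer I f hf a ha))) :=
    (isSmoothAt_map_mk_iff (chartKer I f hf a ha) 𝔮 R (hJle.trans h𝔮₀𝔮)).mpr hfsq
  have hkerT𝔮 : 𝔮.map (Ideal.Quotient.mk (chartKer I f hf a ha)) =
      (maximalIdeal R').comap (algebraMap (Chart f a ha ⧸ chartKer I f hf a ha) R') := by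
    rw [h𝔮, IsScalarTower.algebraMap_eq (Chart f a ha) (Chart f a ha ⧸ chartKer I f hf a ha) R',
      ← Ideal.comap_comap, Ideal.Quotient.algebraMap_eq,
      Ideal.map_comap_of_surjective _ Ideal.Quotient.mk_surjective]
  have hkerT𝔮' : ((maximalIdeal R').comap (algebraMap (ALoc I f hf a ha) R')).comap
        (chartQuotEquiv I f hf a ha).toRingEquiv.toRingHom =
      (maximalIdeal R').comap (algebraMap (Chart f a ha ⧸ chartKer I f hf a ha) R') := by
    rw [Ideal.comap_comap]
    rfl
  have hkerA𝔭 : ((maximalIdeal R').comap (algebraMap (ALoc I f hf a ha) R')).comap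
        (algebraMap (MvPolynomial (Fin n) R ⧸ I) (ALoc I f hf a ha)) =
      (maximalIdeal R').comap (algebraMap (MvPolynomial (Fin n) R ⧸ I) R') := by
    rw [Ideal.comap_comap, ← IsScalarTower.algebraMap_eq]
  have key : Algebra.IsSmoothAt R (((maximalIdeal R').comap (algebraMap (ALoc I f hf a ha) R')).comap
      (algebraMap (MvPolynomial (Fin n) R ⧸ I) (ALoc I f hf a ha))) := by
    refine (isSmoothAt_chartQuot_iff I f hf a ha
      ((maximalIdeal R').comap (algebraMap (ALoc I f hf a ha) R'))).mp ?_
    convert hT𝔮 using 2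
    exact hkerT𝔮'.trans hkerT𝔮.symm
  convert key using 2
  exact hkerA𝔭.symm


/-- **BLR Lemma 3.3/1 ⟹, flat form**: as `isSmoothAt_of_free_baseChange_kaehler`, with the
pull-back `R' ⊗_A Ω[A⁄R]` of the differentials assumed FLAT over the local domain `R'` (a
finitely generated flat module over a local ring is free, Stacks 00NZ; over a valuation ring
`R'` flat = torsion-free, so this is literally "`a*Ω¹` has no torsion", i.e. `δ(a) = 0`).
[cite: Artin1986NeronModels, (3.8) (p. 226)] -/
theorem isSmoothAt_of_flat_baseChange_kaehler
    (hQ : Algebra.IsSmoothAt R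
      ((⊥ : Ideal R').comap (algebraMap (MvPolynomial (Fin n) R ⧸ I) R')))
    (hflat : Module.Flat R'
      (R' ⊗[MvPolynomial (Fin n) R ⧸ I] Ω[(MvPolynomial (Fin n) R ⧸ I)⁄R])) :
    Algebra.IsSmoothAt R
      ((maximalIdeal R').comap (algebraMap (MvPolynomial (Fin n) R ⧸ I) R')) := by
  haveI : Module.Finite (MvPolynomial (Fin n) R ⧸ I) Ω[(MvPolynomial (Fin n) R ⧸ I)⁄R] :=
    inferInstance
  haveI := hflat
  exact isSmoothAt_of_free_baseChange_kaehler I R' hQ (Module.free_of_flat_of_isLocalRing)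

end Main

end Literature.AlgebraicGeometry.Smoothening

end
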